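import Summits.BirchSwinnertonDyer.BirchSwinnertonDyer.Theorems.KimAtThreeShallowEqDeepAnomalousRiderOfCompat
import Summits.BirchSwinnertonDyer.BirchSwinnertonDyer.Theorems.KimAtThreeShallowEqDeepMultOfDefinedKato
import Summits.BirchSwinnertonDyer.BirchSwinnertonDyer.Theorems.KimAtThreeShallowEqDeepNonAdditiveOfFineKato
import Literature.NumberTheory.EllipticCurves.LFunctionPrimeCoeff
import Literature.NumberTheory.EllipticCurves.SupersingularDensitySerreFrobeniusProofs
import Literature.NumberTheory.EllipticCurves.LeadingTermTamagawaProofs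
import Literature.NumberTheory.EllipticCurves.ComplexMultiplicationCoatesWilesReductionIndexProofs
import Literature.NumberTheory.EllipticCurves.TamagawaSubgroupProofs
import HarnessLib

/-!
# Route `KimAtThreeKolyvagin` (W2): gen 9's fine Kato package (C1_τ) of the GOOD rows (anomalous included) DERIVED
# from a φ-level DEFINED-KATO package with the Euler-factor compatibility — so that every good `t = 0` row of
# 19599 / 19077 rests on a defined-Kato-type object, like the deep cruxes and the multiplicative rows

Cell `bsd-addord`, seat `bsd-addord-w2-c4` (gen 10; OWNER of crux 19599 `ShallowEqDeepOffKatoStratum`, item 19077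
`ShallowEqDeepAtTorsionFree`).  `--supports` 19599.  HONEST FRAMING: END-TYPE TOOL THEOREMS WITH DISPLAYED
HYPOTHESES (no definition, no named fact, no instance, no `sorry`); Kato's `Λ` and the scalar dual exponential
`φ` are ABSTRACT binders, the package tying them is DISPLAYED; nothing asserted about any curve, nothing booked;
19560 / 19599 / 19077 stay OPEN; BSD is not proved by any of this.

## What, and why
(C1ₑₓ^τ) at a good row `(W, v₃, P)` := `(ι, κK, Λ, φ)` with `κK` a rational `3`-unit, `hker`, `hdual` (kim3's texts), the
TWISTED compatibility COMPAT_τ «`3•(φ(h) ⊗ 1 − Λ_{0,r}(y)) ∈ 3^{j+1}·Tw_{P_w} L_int`» at every depth (`P_w = 3 − a₃δ_w +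
δ_{w²}`, `w·[3] = 1`; TRUE for Kato's `Λ = exp*` by the LATTICE LEMMA `exp*_ω(H¹(K,T)) = E₃(φ⁻¹)𝓞_K` of memo
W2C4-ANOMALOUS-PORT-g9 §2 — `3E₃(φ⁻¹) = P(φ⁻¹)`, `σ_w = Frob⁻¹`), and Kato's `ZetaBody` family.  THIS FILE shows
(C1ₑₓ^τ) ⟹ (C1_τ) (gen 9's rider-level package) on a GOOD `t = 0` row:
* §1 `natCard_reduction_eq_reductionPointCount`, `reductionPointCount_eq_four_sub` — `#Ẽ(𝔽₃) = 4 − a₃` for the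
  minimal model at a good `3` (`LFunction_apply_prime_eq_frobeniusTrace`), and `a₃² < 12` (Hasse).
* §2 **`exists_twistNormalised_of_dual_of_good`** — from `hdual`, `#E(ℚ₃)[3] = 1`, `c₃ = 1`
  (`localTamagawaNumber_padic_eq_one_of_good_holds`) and n1011's `range_padicLog_eq_span_zpow_of_isMinimal`:
  `exp*_ω(H¹(ℚ₃,T)) = range φ = (#Ẽ(𝔽₃)/3)·ℤ₃` (Kim's Lemma 3.4 AS A THEOREM here), i.e. `φ″ := (3/(4 − a₃))·φ` is
  NORMALISED (integral and onto `ℤ₃`).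
* §3 **`fineKatoτ_of_definedKatoTwist`** — (C1ₑₓ^τ) ⟹ FINEKATOτ: `Λfin` from `φ″`
  (`exists_finLevelFunctional_clauses_of_normalised`), riders by `riderτ_of_compatτ`.
* §4 rows: `shallowEqDeep_row_of_definedKatoTwist` etc. via gen 9's `KimAtThreeShallowEqDeepAnomalousRows`.
READING (08-28): 19599 / 19077's good rows ⟸ PUB ∧ (C1ₑₓ^τ); with p508464 (multiplicative rows ⟸ (C1ₑₓ¹ᵘ)) every
non-additive `t = 0` row rests on a φ-level defined-Kato package whose only non-(C1ₑₓ) clause is the EXACT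
per-row lattice bound (`3M ⊆ L_int′` multiplicative / `3M ⊆ P_w·L_int′` good).
References: [BlochKato1990] §3; [Kato2004Asterisque] §9.4, Thm. 9.7, Ex. 13.3; [Kim2022StructureSelmer] §3.2.3,
Lemma 3.3/3.4, Cor. 3.5, Thm. 3.13; [SilvermanAEC2009] V.1.1, VII.2.1, VII.6, C.16; memo HOME/w2c4/W2C4-MULT-TWOEXP-g10.md §7.
-/

set_option autoImplicit false
-- the Theorems namespace of a single-conjunct summit repeats the summit name by design (D-0017)
set_option linter.dupNamespace false

noncomputable section

open scoped NumberField TensorProduct ContRepresentation Classical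
open CategoryTheory Field Function Finset IsDedekindDomain NumberField WeierstrassCurve
open Rat.HeightOneSpectrum
open Literature.NumberTheory.GaloisRepresentations Literature.NumberTheory.GaloisCohomology
open Literature.NumberTheory.GaloisRepresentations.DiscreteGaloisModule
open Literature.NumberTheory.EllipticCurves Literature.NumberTheory.EllipticCurves.ModularForms
open Literature.NumberTheory.EllipticCurves.Rank1Residual
open Literature.NumberTheory.EllipticCurves.Kato2004
open Literature.NumberTheory.EllipticCurves.Kato2004.EulerSystemValues
open Summit.BirchSwinnertonDyer.Rank1Residual.GaloisImage
open Summit.BirchSwinnertonDyer.Rank1Residual.Additive.LocalLog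
open Summit.BirchSwinnertonDyer.BirchSwinnertonDyer.Theorems
open Summit.BirchSwinnertonDyer.BirchSwinnertonDyer.Theorems.KimAtThreeKolyvaginDefs
open Summit.BirchSwinnertonDyer.BirchSwinnertonDyer.Theorems.KimAtThreeDeepUpperLocalLatticeUniform
open Summit.BirchSwinnertonDyer.BirchSwinnertonDyer.Theorems.KimAtThreeShallowEqDeepMultOfDefinedKato
open Summit.BirchSwinnertonDyer.BirchSwinnertonDyer.Theorems.KimAtThreeShallowEqDeepAnomalousRiderOfCompat
open Summit.BirchSwinnertonDyer.BirchSwinnertonDyer.Theorems.KimAtThreeShallowEqDeepNonAdditiveOfFineKato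

namespace Summit.BirchSwinnertonDyer.BirchSwinnertonDyer.Theorems.KimAtThreeShallowEqDeepGoodOfDefinedKato

/-! ### The displayed packages (local notation) -/
/-- Local notation: the TWISTED rider clause (ii_τ) at depth `j`, place `v`, integer model `t₃` of `a₃`, for
the pair `(Λ, Λf)` — premise on the Euler-factor lattice `(1 ⊗ (3 − t₃δ_w + δ_{w²}))·L_int` (`w·[3] = 1`),
scalar `s·(3 − t₃ + 1)` (this seat's gen 9, VERBATIM). -/
local notation3 (prettyPrint := false) "RIDERτ⟦" W' ", " j ", " v' ", " t3 ", " Λ' ", " Λf "⟧" =>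
  ∀ (r : Finset (HeightOneSpectrum (𝓞 ℚ))) (w : (ZMod (cycLevel 3 0 r))ˣ),
    (w : ZMod (cycLevel 3 0 r)) * ((3 : ℕ) : ZMod (cycLevel 3 0 r)) = 1 →
    ∀ (Ψ : H1 (tateRep W' 3) (cycSubgroup 3 0 r) →+
        continuousCohomology 1
          (subgroupRep (WeierstrassCurve.torsionGaloisModule W' (((3 : ℕ) : ℤ) ^ j * ((3 : ℕ) : ℤ))).toTopRep
            (cycSubgroup 3 0 r))),
      (∀ (φ : contOneCocycles (subgroupRep (tateRep W' 3).toTopRep (cycSubgroup 3 0 r)))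
          (ψ : contOneCocycles
            (subgroupRep (WeierstrassCurve.torsionGaloisModule W' (((3 : ℕ) : ℤ) ^ j * ((3 : ℕ) : ℤ))).toTopRep
              (cycSubgroup 3 0 r))),
          (∀ g, ((ψ.1 g : geomTorsion W' (((3 : ℕ) : ℤ) ^ j * ((3 : ℕ) : ℤ))) : geomPoints W') =
            TateModule.proj 3 (j + 1) (φ.1 g)) →
          Ψ (oneCocycleClass _ φ) = oneCocycleClass _ ψ) →
      ∀ (y : H1 (tateRep W' 3) (cycSubgroup 3 0 r))
        (κ₀ : galoisCohomology (WeierstrassCurve.torsionGaloisModule W' (((3 : ℕ) : ℤ) ^ j * ((3 : ℕ) : ℤ))) 1)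
        (s : ℤ_[3]),
        resSubgroup (WeierstrassCurve.torsionGaloisModule W' (((3 : ℕ) : ℤ) ^ j * ((3 : ℕ) : ℤ))).toTopRep
            (cycSubgroup 3 0 r) 1 κ₀ = Ψ y →
        galoisCohomology.localization (WeierstrassCurve.torsionGaloisModule W' (((3 : ℕ) : ℤ) ^ j * ((3 : ℕ) : ℤ)))
            (Sum.inr v') 1 κ₀ ∈ propagatedSelmerStructure W' 3 j (Sum.inr v') →
        (∃ l ∈ cycIntLattice 3 (cycLevel 3 0 r),
            ((3 : ℕ) : ℤ_[3]) • Λ' 0 r y -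
                (((s * (((3 : ℕ) : ℤ_[3]) - (t3 : ℤ_[3]) + 1) : ℤ_[3]) : ℚ_[3]) ⊗ₜ[ℚ]
                  (1 : CyclotomicField (cycLevel 3 0 r) ℚ)) =
              ((3 : ℤ_[3]) ^ (j + 1)) • ∑ g : (ZMod (cycLevel 3 0 r))ˣ,
                ((((((3 : ℕ) : MonoidAlgebra ℤ_[3] (ZMod (cycLevel 3 0 r))ˣ)) -
                    MonoidAlgebra.single w (t3 : ℤ_[3]) +
                    MonoidAlgebra.single (w ^ 2) (1 : ℤ_[3])).coeff g : ℤ_[3]) : ℚ_[3]) •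
                  Algebra.TensorProduct.map (AlgHom.id ℚ ℚ_[3])
                    (sigma (cycLevel 3 0 r) g : CyclotomicField (cycLevel 3 0 r) ℚ →ₐ[ℚ]
                      CyclotomicField (cycLevel 3 0 r) ℚ) l) →
        Λf (galoisCohomology.localization (WeierstrassCurve.torsionGaloisModule W' (((3 : ℕ) : ℤ) ^ j * ((3 : ℕ) : ℤ)))
            (Sum.inr v') 1 κ₀) = PadicInt.toZModPow (j + 1) s

/-- Local notation: the (Λ)-clauses of DICT3 for the finite-level functional `Λf j` at `v` (onto `ℤ/3^{j+1}` on
`𝓕_can(v)`, kernel the Kummer part). -/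
local notation3 (prettyPrint := false) "LAMBDA⟦" W' ", " v' ", " Λf "⟧" =>
  ∀ j : ℕ,
    (∀ c : ZMod (3 ^ (j + 1)), ∃ x ∈ propagatedSelmerStructure W' 3 j (Sum.inr v'), Λf j x = c) ∧
    (∀ x ∈ propagatedSelmerStructure W' 3 j (Sum.inr v'),
      Λf j x = 0 ↔ x ∈ WeierstrassCurve.kummerSelmerStructure W' (((3 : ℕ) : ℤ) ^ j * ((3 : ℕ) : ℤ)) (Sum.inr v'))

/-- Local notation: Kato's `ZetaBody` FAMILY for `(ι, κK, Λ)` and the cusp form `f'` at level `N'`. -/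
local notation3 (prettyPrint := false) "ZBODY⟦" W' ", " N' ", " f' ", " ι' ", " κ' ", " Λ' "⟧" =>
  ∀ (c d a : ℤ) (A : ℕ), 0 < A → Int.gcd c (6 * 3 * A) = 1 → Int.gcd d (6 * 3 * N') = 1 →
    ∃ (z : ∀ (k' : ℕ) (r : (cyclotomicLevelsRat 3 (badPlaces c d A N')).Ideals),
          H1 (tateRep W' 3) ((cyclotomicLevelsRat 3 (badPlaces c d A N')).level k' r.1))
      (x : ∀ (k' : ℕ) (r : (cyclotomicLevelsRat 3 (badPlaces c d A N')).Ideals),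
          CyclotomicField (cycLevel 3 k' r.1) ℚ),
      ZetaBody W' 3 f' ι' κ' Λ' c d a A z x

/-- Local notation: **(C1_τ) at the row `(W, v, D)`** — gen 9's fine Kato package on the Euler-factor lattice
(`t₃` an integer model of `a₃(f)`), instance binders universally quantified. -/
local notation3 (prettyPrint := false) "FINEKATOτ⟦" W' ", " v' ", " N' ", " D' ", " t3 "⟧" =>
  ∀ [ContinuousSMul ℤ_[3] (WeierstrassCurve.tateModule W' 3)] [Module.Free ℤ_[3] (WeierstrassCurve.tateModule W' 3)]
    [Module.Finite ℤ_[3] (WeierstrassCurve.tateModule W' 3)],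
    ∃ (ι : (n : ℕ) → (CyclotomicField n ℚ →+* ℂ)) (κK : ℝ)
      (Λ : ∀ (k' : ℕ) (r : Finset (HeightOneSpectrum (𝓞 ℚ))),
        H1 (tateRep W' 3) (cycSubgroup 3 k' r) →ₗ[ℤ_[3]]
          ℚ_[3] ⊗[ℚ] CyclotomicField (cycLevel 3 k' r) ℚ)
      (Λfin : ∀ j : ℕ, galoisCohomology
        ((WeierstrassCurve.torsionGaloisModule W' (((3 : ℕ) : ℤ) ^ j * ((3 : ℕ) : ℤ))).toLocal (Sum.inr v')) 1 →+
          ZMod (3 ^ (j + 1))),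
      κK ≠ 0 ∧ (∃ u : ℚ, (u : ℝ) = κK ∧ padicValRat 3 u = 0) ∧
      (LAMBDA⟦W', v', Λfin⟧) ∧
      (∀ j : ℕ, RIDERτ⟦W', j, v', t3, Λ, Λfin j⟧) ∧
      ZBODY⟦W', N', (D' : ModularParametrizationData W' N').f, ι, κK, Λ⟧

/-- Local notation: the TWISTED compatibility COMPAT_τ at depth `j` between `Λ_{0,r}` and `φ` (place `v`, model
`t₃`): «`3•(φ(h) ⊗ 1 − Λ_{0,r}(y)) ∈ 3^{j+1}·Tw_{P_w} L_int`» for every `T`-lift `h` of `loc_v κ₀`, `res κ₀ = Ψ y`,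
and every `w` with `w·[3] = 1`. -/
local notation3 (prettyPrint := false) "COMPATτ⟦" W' ", " j ", " v' ", " t3 ", " Λ' ", " φ0 "⟧" =>
  ∀ (r : Finset (HeightOneSpectrum (𝓞 ℚ))) (w : (ZMod (cycLevel 3 0 r))ˣ),
    (w : ZMod (cycLevel 3 0 r)) * ((3 : ℕ) : ZMod (cycLevel 3 0 r)) = 1 →
    ∀ (Ψ : H1 (tateRep W' 3) (cycSubgroup 3 0 r) →+
      continuousCohomology 1 (subgroupRep
        (WeierstrassCurve.torsionGaloisModule W' (((3 : ℕ) : ℤ) ^ j * ((3 : ℕ) : ℤ))).toTopRep (cycSubgroup 3 0 r))),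
    (∀ (φ₁ : contOneCocycles (subgroupRep (tateRep W' 3).toTopRep (cycSubgroup 3 0 r)))
        (ψ : contOneCocycles (subgroupRep
          (WeierstrassCurve.torsionGaloisModule W' (((3 : ℕ) : ℤ) ^ j * ((3 : ℕ) : ℤ))).toTopRep (cycSubgroup 3 0 r))),
        (∀ g, ((ψ.1 g : geomTorsion W' (((3 : ℕ) : ℤ) ^ j * ((3 : ℕ) : ℤ))) : geomPoints W') =
          TateModule.proj 3 (j + 1) (φ₁.1 g)) →
        Ψ (oneCocycleClass _ φ₁) = oneCocycleClass _ ψ) →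
    ∀ (y : H1 (tateRep W' 3) (cycSubgroup 3 0 r))
      (κ₀ : galoisCohomology (WeierstrassCurve.torsionGaloisModule W' (((3 : ℕ) : ℤ) ^ j * ((3 : ℕ) : ℤ))) 1)
      (h : (tateLocalRep W' 3 (Sum.inr v')).cohomology 1),
      resSubgroup (WeierstrassCurve.torsionGaloisModule W' (((3 : ℕ) : ℤ) ^ j * ((3 : ℕ) : ℤ))).toTopRep
          (cycSubgroup 3 0 r) 1 κ₀ = Ψ y →
      galoisCohomology.localization (WeierstrassCurve.torsionGaloisModule W' (((3 : ℕ) : ℤ) ^ j * ((3 : ℕ) : ℤ)))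
          (Sum.inr v') 1 κ₀ = tateLocalMap W' 3 j (Sum.inr v') h →
      ∃ l ∈ cycIntLattice 3 (cycLevel 3 0 r),
        ((3 : ℕ) : ℤ_[3]) • ((φ0 h ⊗ₜ[ℚ] (1 : CyclotomicField (cycLevel 3 0 r) ℚ)) - Λ' 0 r y) =
          ((3 : ℤ_[3]) ^ (j + 1)) • ∑ g : (ZMod (cycLevel 3 0 r))ˣ,
            ((((((3 : ℕ) : MonoidAlgebra ℤ_[3] (ZMod (cycLevel 3 0 r))ˣ)) -
                MonoidAlgebra.single w (t3 : ℤ_[3]) +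
                MonoidAlgebra.single (w ^ 2) (1 : ℤ_[3])).coeff g : ℤ_[3]) : ℚ_[3]) •
              Algebra.TensorProduct.map (AlgHom.id ℚ ℚ_[3])
                (sigma (cycLevel 3 0 r) g : CyclotomicField (cycLevel 3 0 r) ℚ →ₐ[ℚ]
                  CyclotomicField (cycLevel 3 0 r) ℚ) l

/-- Local notation: **(C1ₑₓ^τ) at the row `(W, v, P)` with integer model `t₃` of `a₃`** — the DEFINED-KATO package with the
TWISTED (Euler-factor) compatibility: `(ι, κK, Λ, φ)` with `κK ≠ 0` a rational `3`-adic unit, `hker`, `hdual`, COMPAT_τ at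
every depth, and Kato's `ZetaBody` family for `P.f`. -/
local notation3 (prettyPrint := false) "DEFKATOτ⟦" W' ", " v' ", " N' ", " P' ", " t3 "⟧" =>
  ∃ (ι : (n : ℕ) → (CyclotomicField n ℚ →+* ℂ)) (κK : ℝ)
    (Λ : ∀ (k' : ℕ) (r : Finset (HeightOneSpectrum (𝓞 ℚ))),
      H1 (tateRep W' 3) (cycSubgroup 3 k' r) →ₗ[ℤ_[3]] ℚ_[3] ⊗[ℚ] CyclotomicField (cycLevel 3 k' r) ℚ)
    (φ : (tateLocalRep W' 3 (Sum.inr v')).cohomology 1 →+ ℚ_[3]),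
    κK ≠ 0 ∧ (∃ u : ℚ, (u : ℝ) = κK ∧ padicValRat 3 u = 0) ∧
    (∀ y, φ y = 0 ↔ ∀ j : ℕ, tateLocalMap W' 3 j (Sum.inr v') y ∈
      WeierstrassCurve.kummerSelmerStructure W' (((3 : ℕ) : ℤ) ^ j * ((3 : ℕ) : ℤ)) (Sum.inr v')) ∧
    (∀ a : ℚ_[3], (∃ y, φ y = a) ↔
      ∀ Q : ((W' : WeierstrassCurve ℚ).baseChange ℚ_[3]).toAffine.Point,
        ‖a * padicLog ((W' : WeierstrassCurve ℚ).baseChange ℚ_[3]) Q‖ ≤ 1) ∧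
    (∀ j : ℕ, COMPATτ⟦W', j, v', t3, Λ, φ⟧) ∧
    ZBODY⟦W', N', (P' : ModularParametrizationData W' N').f, ι, κK, Λ⟧

/-! ### §1 The point count of the reduction at a good `3` and Hasse -/

section Count

variable (W : WeierstrassCurve ℚ) [W.IsElliptic] [W.IsGloballyMinimal]

omit [W.IsElliptic] in
/-- `#Ẽ(𝔽₃)` of Mathlib's reduction of the `ℤ₃`-minimal model `W ⊗ ℚ₃` is the tree's `reductionPointCount W 3`
(the `ℤ₃`-model is `integralModelInt W ⊗ ℤ₃`, seat Zywina-road's transport). [folklore] -/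
theorem natCard_reduction_eq_reductionPointCount :
    Nat.card ((W.baseChange ℚ_[3]).reduction ℤ_[3]).toAffine.Point = reductionPointCount W 3 := by
  haveI : (W.baseChange ℚ_[3]).IsMinimal ℤ_[3] := isMinimal_map_padic_of_isGloballyMinimal W 3
  have key : ∀ (X : WeierstrassCurve ℚ_[3]) [X.IsMinimal ℤ_[3]],
      ((integralModelInt W).map (Int.castRingHom ℤ_[3])).baseChange ℚ_[3] = X →
        Nat.card (X.reduction ℤ_[3]).toAffine.Point = reductionPointCount W 3 := by
    intro X _ hX
    subst hX
    rw [reduction_baseChange_eq]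
    exact natCard_point_padicModel_residue W 3
  exact key _ (padicModel_baseChange W 3)

/-- At a good `3`: `#Ẽ(𝔽₃) = 4 − a₃(W)` with `a₃ = L(W)_3` and `a₃² < 12` (Hasse). [cite: SilvermanAEC2009, Thm. V.1.1 and §C.16] -/
theorem reductionPointCount_eq_four_sub (hgood : W.HasGoodReductionAtPrime 3) :
    ((reductionPointCount W 3 : ℕ) : ℤ) = 4 - W.LFunction 3 ∧ (W.LFunction 3) ^ 2 < 12 := by
  have hL := LFunction_apply_prime_eq_frobeniusTrace W 3 hgood
  have hH := W.frobeniusTrace_sq_le_four_mul 3 hgood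
  rw [← hL] at hH
  have hH' : W.LFunction 3 ^ 2 ≤ 12 := by
    have h := hH; push_cast at h; linarith
  refine ⟨?_, ?_⟩
  · rw [hL, WeierstrassCurve.frobeniusTrace]; push_cast; ring
  · have h1 : W.LFunction 3 ≤ 3 := by nlinarith [hH']
    have h2 : -3 ≤ W.LFunction 3 := by nlinarith [hH']
    nlinarith [h1, h2]

end Count

/-! ### §2 Normalisation at a good `t = 0` row: `exp*_ω(H¹(ℚ₃,T)) = (#Ẽ(𝔽₃)/3)·ℤ₃` from `hdual` -/

section Normalise

variable (W : WeierstrassCurve ℚ) [W.IsElliptic] [W.IsGloballyMinimal]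
  (v : Place ℚ) (φ : (tateLocalRep W 3 v).cohomology 1 →+ ℚ_[3])

set_option backward.isDefEq.respectTransparency false in
/-- **Kim's Lemma 3.4 at `p = 3` AS A THEOREM from `hdual`, and the twisted normalisation.**  At a good `t = 0` row
with `#Ẽ(𝔽₃) = 4 − t₃`: `log_ω(E(ℚ₃)) = 3^{1 − v₃(4 − t₃)}ℤ₃` (n1011's `range_padicLog_eq_span_zpow_of_isMinimal`, `c₃ = 1`,
`3 ∤ #E(ℚ₃)_tors`), so by `hdual` the range of `φ = exp*_ω` is `((4 − t₃)/3)·ℤ₃` and `φ″ := (3/(4 − t₃))·φ` is integral and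
ONTO `ℤ₃`. [cite: Kim2022StructureSelmer, Lemma 3.4 and §3.2.3 (PDF pp. 16–17)] [cite: BlochKato1990, §3 (Prop. 3.8)]
[cite: SilvermanAEC2009, IV.6.4, VII.2.1 and VII.6.3] -/
theorem exists_twistNormalised_of_dual_of_good
    (hdual : ∀ a : ℚ_[3], (∃ y, φ y = a) ↔
      ∀ P : (W.baseChange ℚ_[3]).toAffine.Point, ‖a * padicLog (W.baseChange ℚ_[3]) P‖ ≤ 1)
    (ht : Nat.card {Q : (W.baseChange ℚ_[3]).toAffine.Point // (3 : ℕ) • Q = 0} = 1)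
    (hgood : W.HasGoodReductionAtPrime 3) {t₃ : ℤ} (ht₃ : ((reductionPointCount W 3 : ℕ) : ℤ) = 4 - t₃) :
    ∃ (φ'' : (tateLocalRep W 3 v).cohomology 1 →+ ℚ_[3]) (u : ℚ_[3]), u ≠ 0 ∧
      u * (((4 : ℤ) - t₃ : ℤ) : ℚ_[3]) = 3 ∧ (∀ y, φ'' y = u * φ y) ∧
      (∀ y, ‖φ'' y‖ ≤ 1) ∧ (∀ s : ℤ_[3], ∃ y, φ'' y = s) := by
  haveI : (W.baseChange ℚ_[3]).IsMinimal ℤ_[3] := isMinimal_map_padic_of_isGloballyMinimal W 3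
  set n₃ : ℕ := reductionPointCount W 3 with hn₃
  have hn₃0 : n₃ ≠ 0 := by
    intro h0
    rw [h0] at ht₃
    have := (reductionPointCount_eq_four_sub W hgood).2
    have hL : W.LFunction 3 = 4 := by
      have := (reductionPointCount_eq_four_sub W hgood).1
      rw [← hn₃, h0] at this; push_cast at this; linarith
    rw [hL] at this; norm_num at this
  -- the exponent of the log lattice
  set e : ℤ := (1 : ℤ) + padicValNat 3 (Nat.card (AddCommGroup.torsion (W.baseChange ℚ_[3]).toAffine.Point)) -
      padicValNat 3 ((W.baseChange ℚ_[3]).localTamagawaNumber ℤ_[3]) -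
      padicValNat 3 (Nat.card ((W.baseChange ℚ_[3]).reduction ℤ_[3]).toAffine.Point) with he
  have hrange := range_padicLog_eq_span_zpow_of_isMinimal (W.baseChange ℚ_[3])
  have htors : padicValNat 3 (Nat.card (AddCommGroup.torsion (W.baseChange ℚ_[3]).toAffine.Point)) = 0 :=
    padicValNat_card_torsion_eq_zero_of_card_torsionBy_eq_one 3 ht
  have hc : (W.baseChange ℚ_[3]).localTamagawaNumber ℤ_[3] = 1 :=
    localTamagawaNumber_padic_eq_one_of_good_holds W 3 hgood
  have hcard := natCard_reduction_eq_reductionPointCount W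
  have he' : e = 1 - (padicValNat 3 n₃ : ℤ) := by
    rw [he, htors, hc, hcard, padicValNat_one_right]; push_cast; ring
  -- `a ∈ range φ ↔ ‖a · 3^e‖ ≤ 1`
  have hiff : ∀ a : ℚ_[3], (∃ y, φ y = a) ↔ ‖a * (3 : ℚ_[3]) ^ e‖ ≤ 1 := by
    intro a
    rw [hdual a]
    constructor
    · intro h
      have hmem : ((3 : ℕ) : ℚ_[3]) ^ e ∈ (padicLog (W.baseChange ℚ_[3])).range := by
        rw [hrange, Submodule.mem_toAddSubgroup]
        exact Submodule.mem_span_singleton_self _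
      obtain ⟨P, hP⟩ := hmem
      have h' := h P
      rwa [hP, Nat.cast_ofNat] at h'
    · intro ha P
      have hP : padicLog (W.baseChange ℚ_[3]) P ∈ (padicLog (W.baseChange ℚ_[3])).range := ⟨P, rfl⟩
      rw [hrange, Submodule.mem_toAddSubgroup, Submodule.mem_span_singleton] at hP
      obtain ⟨c, hc'⟩ := hP
      rw [← hc', Algebra.smul_def, PadicInt.algebraMap_apply, ← mul_assoc, mul_comm a, mul_assoc, norm_mul,
        Nat.cast_ofNat]
      exact mul_le_one₀ (PadicInt.norm_le_one c) (norm_nonneg _) ha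
  -- the twist scalar `u = 3 / #Ẽ(𝔽₃)`
  have hP1Q : (((4 : ℤ) - t₃ : ℤ) : ℚ_[3]) = ((n₃ : ℚ) : ℚ_[3]) := by
    rw [← ht₃]; push_cast; rfl
  have hn₃Q : ((n₃ : ℚ) : ℚ_[3]) ≠ 0 := by exact_mod_cast hn₃0
  set u : ℚ_[3] := (3 : ℚ_[3]) / ((n₃ : ℚ) : ℚ_[3]) with hu
  have hu0 : u ≠ 0 := div_ne_zero (by norm_num) hn₃Q
  have huP : u * (((4 : ℤ) - t₃ : ℤ) : ℚ_[3]) = 3 := by rw [hP1Q, hu, div_mul_cancel₀ _ hn₃Q]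
  -- ‖u‖ = 3^{v - 1}
  have hnorm_n : ‖((n₃ : ℚ) : ℚ_[3])‖ = (3 : ℝ) ^ (-(padicValNat 3 n₃ : ℤ)) := by
    rw [Padic.eq_padicNorm, padicNorm.eq_zpow_of_nonzero (by exact_mod_cast hn₃0), padicValRat.of_nat]
    push_cast
    rfl
  have h3 : ‖(3 : ℚ_[3])‖ = (3 : ℝ)⁻¹ := by
    have := Padic.norm_p (p := 3); simpa using this
  have hnorm_u : ∀ a : ℚ_[3], ‖u * a‖ = ‖a * (3 : ℚ_[3]) ^ e‖ := by
    intro a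
    rw [norm_mul, norm_mul, hu, norm_div, norm_zpow, h3, he', hnorm_n, inv_zpow', ← zpow_neg_one, div_eq_mul_inv,
      ← zpow_neg, neg_neg, ← zpow_add₀ (by norm_num : (3 : ℝ) ≠ 0), mul_comm]
    congr 2
    ring
  refine ⟨(AddMonoidHom.mulLeft u).comp φ, u, hu0, huP, fun y => rfl, fun y => ?_, fun s => ?_⟩
  · rw [AddMonoidHom.comp_apply, AddMonoidHom.coe_mulLeft, hnorm_u]
    exact (hiff (φ y)).mp ⟨y, rfl⟩
  · obtain ⟨y, hy⟩ := (hiff ((s : ℚ_[3]) * u⁻¹)).mpr (by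
      rw [← hnorm_u, mul_comm, inv_mul_cancel_right₀ hu0]; exact PadicInt.norm_le_one s)
    refine ⟨y, ?_⟩
    rw [AddMonoidHom.comp_apply, AddMonoidHom.coe_mulLeft, hy, mul_comm, inv_mul_cancel_right₀ hu0]

end Normalise

/-! ### §3 (C1_τ) from the defined-Kato package with the twisted compatibility -/

section Row

variable (W : WeierstrassCurve ℚ) [W.IsElliptic] [W.IsGloballyMinimal]

set_option backward.isDefEq.respectTransparency false in
/-- **(C1ₑₓ^τ) ⟹ (C1_τ) at a good `t = 0` row.**  For a globally minimal `W` with GOOD reduction at `3`, a place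
`v₃ ∣ 3`, `#E(ℚ₃)[3] = 1`, a parametrisation datum `P` and the integer model `t₃` of `a₃(P.f)`: the defined-Kato
package with the twisted compatibility yields gen 9's fine package (C1_τ) — `Λfin` from the normalised
`φ″ = (3/(4 − a₃))·φ` (§2, `exists_finLevelFunctional_clauses_of_normalised`, `hker` transported), the twisted
riders by `riderτ_of_compatτ` (injectivity of the twist operator; NO digit lost).  Nothing constructed; nothing
booked. [cite: Kim2022StructureSelmer, Lemma 3.4, Cor. 3.5, Thm. 3.13] [cite: BlochKato1990, §3 (Prop. 3.8, Ex. 3.11)]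
[cite: Kato2004Asterisque, §9.4 (p. 188) and Thm. 9.7 (p. 189)] -/
theorem fineKatoτ_of_definedKatoTwist {N : ℕ} [NeZero N] (P : ModularParametrizationData W N)
    (hgood : W.HasGoodReductionAtPrime 3)
    {v₃ : HeightOneSpectrum (𝓞 ℚ)}
    (ht : Nat.card {Q : (W.baseChange ℚ_[3]).toAffine.Point // (3 : ℕ) • Q = 0} = 1)
    {t₃ : ℤ} (ht₃ : cuspCoeff P.f 3 = t₃)
    (hKU : ∀ [ContinuousSMul ℤ_[3] (W.tateModule 3)] [Module.Free ℤ_[3] (W.tateModule 3)]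
      [Module.Finite ℤ_[3] (W.tateModule 3)], DEFKATOτ⟦W, v₃, N, P, t₃⟧) :
    FINEKATOτ⟦W, v₃, N, P, t₃⟧ := by
  intro _ _ _
  obtain ⟨ι, κK, Λ, φ, hκ0, hunit, hker, hdual, hcompat, hz⟩ := hKU
  -- `t₃ = a₃(W)`, `#Ẽ(𝔽₃) = 4 − t₃`, Hasse
  have hf := P.isNewformOf
  have ht₃L : t₃ = W.LFunction 3 := by
    have h := hf.2 3
    rw [ht₃] at h
    exact_mod_cast h
  obtain ⟨hcount, hH⟩ := reductionPointCount_eq_four_sub W hgood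
  rw [← ht₃L] at hcount hH
  -- normalise
  obtain ⟨φ'', u, hu0, huP, hφ'', hint'', hsurj''⟩ :=
    exists_twistNormalised_of_dual_of_good W (Sum.inr v₃) φ hdual ht hgood hcount
  have hker'' := hker_of_eq_mul W 3 (Sum.inr v₃) φ (φ' := φ'') (c := u⁻¹) (inv_ne_zero hu0)
    (fun y => by rw [hφ'' y, ← mul_assoc, inv_mul_cancel₀ hu0, one_mul]) hker
  obtain ⟨Λfin, hΛ, hI⟩ :=
    exists_finLevelFunctional_clauses_of_normalised W 3 (Sum.inr v₃) φ'' hint'' hsurj'' hker''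
  have hrid := fun j => riderτ_of_compatτ W v₃ Λ φ φ'' hH u huP hφ'' hint'' j (Λfin j) (hI j) (hcompat j)
  exact ⟨ι, κK, Λ, Λfin, hκ0, hunit, hΛ, hrid, hz⟩

end Row

end Summit.BirchSwinnertonDyer.BirchSwinnertonDyer.Theorems.KimAtThreeShallowEqDeepGoodOfDefinedKato

end
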